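import Summits.QuantumAdvantage.QuantumAdvantage.Theorems.CubicForrelationNearExactIsExactTwelveDigitDualForm
import Summits.QuantumAdvantage.QuantumAdvantage.Theorems.CubicForrelationNearExactIsExactTwelveDigitPairing
import Summits.QuantumAdvantage.QuantumAdvantage.Theorems.CubicForrelationNearExactIsExactTwelveDigitFlats
import Summits.QuantumAdvantage.QuantumAdvantage.Theorems.CubicForrelationNearExactIsExactTwelveDigitClass

/-!
# Crux `CubicForrelation.NearExactIsExact` (stmt-QuantumAdvantage-14043) — n = 12: the digit class of a type-O cubic has NO PERIOD

Certificate seat `b2b-cforr-cert` (gen 33).  HONEST FRAMING: kernel-checked finite-slice theorem (standard axioms) about cubic Boolean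
functions on 12 bits — the first consequence of the dual form lemma (…TwelveDigitDualForm) and the inverse pairing (…TwelveDigitPairing)
for the remaining case "E1280-even" of the open window `(57/64, 29/32)` (…TwelveDigitWeightReduction).  NO value of `θ₁₂`; NOT summit
progress.

Setting: `g = polyPhase p` cubic on 12 bits of TYPE O (`W_g = 16u`, all `u` odd); `κ = [u ≡ ±1 (mod 8)]` its DIGIT CLASS (a cubic,
`tdw_digitClass_cubic`: `1 ⊕ [u₁ odd] ⊕ [u₂ odd]`, `digit_two` / `digit_three`).
* `tdn_N4_odd`: type O ⇒ the number `N₄` of perfect matchings of the 12 variables by cubic monomials of `p` is odd (`no_caseA`, step 1).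
* `tdn_tilings3_eq_zero`: three monomials cover at most `9` variables.
* `tdn_noPeriod` (**no period**): for every `a ≠ 0`, `κ(x ⊕ a) ≠ κ(x)` for some `x`.  Proof: a period `a ∋ v` would give, for every monomial
  `s = x_v x_j x_k`, `Σ_{w ∈ supp a ∖ {j,k}} #(κ ∩ E_{wjk}) ≡ 0` (`tdn_flat2_count` + periodicity), i.e. by the dual form lemma
  `Σ_w N₃({w,j,k}ᶜ) ≡ 0`; summing over `s ∋ v` and exchanging sums gives `Σ_{w ∈ supp a} Σ_{s ∋ v, w ∉ s∖v} N₃ ≡ 0`, while the pairing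
  identities (`tdp_card_saturated_four_at`, `tdp_offdiag_even`) evaluate the same double sum to `N₄ + (even) ≡ 1`.
  Consequence for E1280-even: in the light-derivative analysis of the digit class (`tow_light_derivative`, `tow_quadratic_light`) the
  PERIOD case is impossible; only the rank-2 ("R2") and rank-4 ("R4") light derivatives remain (…TwelveDigitLight).

References: J. Ax (1964) / R. J. McEliece (1972); C. Carlet (2021) §2.2; MacWilliams–Sloane (1977) Ch. 13.  Axioms: the standard three.
-/

set_option linter.dupNamespace false -- D-0017: single-problem summit ⇒ `QuantumAdvantage.QuantumAdvantage` by design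

noncomputable section

namespace Summit.QuantumAdvantage.QuantumAdvantage.Theorems.CubicForrelation.NearExactIsExact

open Finset
open Literature.Computability.QuantumComplexity
open Literature.Computability.QuantumComplexity.BuzetChailloux (bxor zeroVec bxor_bxor_cancel_left bxor_zeroVec zeroVec_bxor bxor_comm
  bxor_self)
open Literature.Computability.QuantumComplexity.DerivativeWalsh (W)
open Summit.QuantumAdvantage.QuantumAdvantage.Theorems.NearExactIsExact.Negative.TypeOTwelve
  (cube_bias_congr card_cube_int digit_two digit_three)

/-! ### The digit class and the matchings of the monomial 3-graph -/

section NoPeriod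

variable (g : (Fin (6 + 6) → Bool) → Bool) (p : MvPolynomial (Fin (6 + 6)) (ZMod 2)) (u : (Fin (6 + 6) → Bool) → ℤ)

/-- **Type O ⇒ `N₄` odd.**  For a type-O cubic `g = polyPhase p` on 12 bits, the number of `4`-sets of monomials of `p` tiling all `12`
variables (perfect matchings of the monomial 3-graph) is odd (`cube_bias_congr` with `m = 4` at the point of `E_∅`; step (1) of
`no_caseA`). [this work] -/
theorem tdn_N4_odd (hp : p.totalDegree ≤ 3) (hrep : ∀ x, g x = polyPhase p x)
    (hu : ∀ x, W (fun y => signOf (g y)) x = (2 : ℝ) ^ 4 * (u x : ℝ)) (hodd : ∀ x, Odd (u x)) :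
    Odd #{S ∈ p.support.powerset | #S = 4 ∧ (S.biUnion fun s => s.support) = univ} := by
  have hbias : ∑ x ∈ {x : Fin (6 + 6) → Bool | ∀ i, x i = true → i ∈ (univ : Finset (Fin (6 + 6)))}, signOf (g x) =
      ((∑ x ∈ {x : Fin (6 + 6) → Bool | ∀ i, x i = true → i ∈ (univ : Finset (Fin (6 + 6)))},
        ∏ s ∈ p.support, (if (∀ j ∈ s.support, x j = true) then (-1 : ℤ) else 1) : ℤ) : ℝ) := by
    rw [Int.cast_sum]
    exact sum_congr rfl fun x _ => by rw [hrep x, ax_signOf_polyPhase]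
  have hpois : (2 : ℝ) ^ 4 * ∑ x ∈ {x : Fin (6 + 6) → Bool | ∀ i, x i = true → i ∈ (∅ : Finset (Fin (6 + 6)))}, (u x : ℝ) =
      (2 : ℝ) ^ #(∅ : Finset (Fin (6 + 6))) *
        ∑ y ∈ {x : Fin (6 + 6) → Bool | ∀ i, x i = true → i ∈ (∅ : Finset (Fin (6 + 6)))ᶜ}, signOf (g y) := by
    have hP := bb_poisson (fun y => signOf (g y)) (∅ : Finset (Fin (6 + 6)))
    rw [sum_congr rfl fun x _ => hu x, ← mul_sum] at hP
    exact hP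
  obtain ⟨k₄, hk₄⟩ := cube_bias_congr p hp univ 4 (by rw [card_univ, Fintype.card_fin])
  have hE0 : #({x : Fin (6 + 6) → Bool | ∀ i, x i = true → i ∈ (∅ : Finset (Fin (6 + 6)))} : Finset _) = 1 := by
    rw [bb_card_cube, card_empty, pow_zero]
  obtain ⟨a, ha⟩ := card_eq_one.1 hE0
  rw [ha, sum_singleton, card_empty, pow_zero, one_mul, compl_empty, hbias, hk₄] at hpois
  have h0z : (2 : ℤ) ^ 4 * u a = (-2) ^ 4 *
      (#{S ∈ p.support.powerset | #S = 4 ∧ (S.biUnion fun s => s.support) = univ} : ℕ) + 2 ^ (4 + 1) * k₄ := by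
    exact_mod_cast hpois
  have hua : u a % 2 = 1 := Int.odd_iff.1 (hodd a)
  rw [Nat.odd_iff]
  omega

/-- Three monomials of a cubic cover at most `9` variables: `N₃(K) = 0` when `|K| > 9`. -/
theorem tdn_tilings3_eq_zero (hp : p.totalDegree ≤ 3) (K : Finset (Fin (6 + 6))) (hK : 9 < #K) :
    #{S' ∈ p.support.powerset | #S' = 3 ∧ (S'.biUnion fun s => s.support) = K} = 0 := by
  rw [card_eq_zero, filter_eq_empty_iff]
  rintro S' hS' ⟨h3, hU⟩
  have h9 : #(S'.biUnion fun s => s.support) ≤ 3 * #S' := ax_card_biUnion_le hp (mem_powerset.1 hS')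
  rw [hU, h3] at h9
  omega

/-- **NO PERIOD.**  The digit class `κ = [u ≡ ±1 (mod 8)]` of a type-O cubic `g = polyPhase p` on 12 bits has no non-zero period:
for every `a` with some `a v = 1` there is an `x` with `κ(x ⊕ a) ≠ κ(x)`.  (A period would make the "row `v`" of the pairing
`Σ_{w ∈ supp a} Σ_{s ∋ v} N₃` both odd — diagonal `N₄` odd, off-diagonal even — and even — dual form lemma + the vanishing of the ANF of
`D_aκ`.)  Structure for E1280-even; NOT summit progress. [this work] -/
theorem tdn_noPeriod (hp : p.totalDegree ≤ 3) (hrep : ∀ x, g x = polyPhase p x)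
    (hu : ∀ x, W (fun y => signOf (g y)) x = (2 : ℝ) ^ 4 * (u x : ℝ)) (hodd : ∀ x, Odd (u x))
    (a : Fin (6 + 6) → Bool) (v : Fin (6 + 6)) (hv : a v = true) :
    ∃ x : Fin (6 + 6) → Bool, ¬ ((u (bxor x a) % 8 = 1 ∨ u (bxor x a) % 8 = 7) ↔ (u x % 8 = 1 ∨ u x % 8 = 7)) := by
  by_contra hnone
  push Not at hnone
  have hg : IsDegLeFun 3 g := ⟨p, hp, hrep⟩
  set κ : (Fin (6 + 6) → Bool) → Bool := fun x => decide (u x % 8 = 1 ∨ u x % 8 = 7) with hκdef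
  have hκ : IsDegLeFun 3 κ := tdw_digitClass_cubic g u hg hu hodd
  have hper : ∀ x, κ (bxor x a) = κ x := fun x => by
    have h := hnone x
    rw [hκdef]
    by_cases hx : (u x % 8 = 1 ∨ u x % 8 = 7)
    · simp only [decide_eq_true hx, decide_eq_true (h.2 hx)]
    · simp only [decide_eq_false hx, decide_eq_false (fun h' => hx (h.1 h'))]
  -- the support of `a`
  set A : Finset (Fin (6 + 6)) := univ.filter fun i => a i = true with hAdef
  have hvA : v ∈ A := by rw [hAdef, mem_filter]; exact ⟨mem_univ _, hv⟩
  have haA : ∀ l, a l = decide (l ∈ A) := fun l => by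
    rw [hAdef]; simp only [mem_filter, mem_univ, true_and]; cases a l <;> simp
  -- cube counts of `κ`
  set c : Finset (Fin (6 + 6)) → ℤ := fun T =>
    (#(univ.filter fun x : Fin (6 + 6) → Bool => (∀ i, x i = true → i ∈ T) ∧ κ x = true) : ℤ) with hcdef
  -- (*) periodicity + ANF on `2`-cubes: `Σ_{i ∈ A ∖ J} c(J ∪ {i}) ≡ 0 (mod 2)` for every `2`-set `J`
  have hstar : ∀ J : Finset (Fin (6 + 6)), #J = 2 → (∑ i ∈ A \ J, c (insert i J)) % 2 = 0 := by
    intro J hJ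
    have hflat := tdn_flat2_count κ hκ J hJ (A \ J) sdiff_disjoint
    -- periodicity: the translate count equals the cube count
    have htrans : (univ.filter fun y : Fin (6 + 6) → Bool => (∀ l, l ∉ J → y l = decide (l ∈ A \ J)) ∧ κ y = true) =
        (univ.filter fun x : Fin (6 + 6) → Bool => (∀ i, x i = true → i ∈ J) ∧ κ x = true).image (fun x => bxor x a) := by
      ext y
      simp only [mem_filter, mem_univ, true_and, mem_image]
      constructor
      · rintro ⟨hy, hκy⟩
        refine ⟨bxor y a, ⟨fun i hi => ?_, ?_⟩, ?_⟩
        · by_contra hiJ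
          have h1 := hy i hiJ
          have : (bxor y a) i = false := by
            show (y i ^^ a i) = false
            rw [h1, haA i]
            by_cases hiA : i ∈ A <;> simp [hiA, hiJ, mem_sdiff]
          rw [this] at hi
          exact Bool.false_ne_true hi
        · rw [hper]; exact hκy
        · funext i; show ((y i ^^ a i) ^^ a i) = y i; cases y i <;> cases a i <;> rfl
      · rintro ⟨x, ⟨hx, hκx⟩, rfl⟩
        refine ⟨fun l hl => ?_, by rw [hper]; exact hκx⟩
        show (x l ^^ a l) = decide (l ∈ A \ J)
        have hxl : x l = false := by
          cases h : x l
          · rfl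
          · exact absurd (hx l h) hl
        rw [hxl, haA l]
        by_cases hlA : l ∈ A <;> simp [hlA, hl, mem_sdiff]
    have hinj : Function.Injective (fun x : Fin (6 + 6) → Bool => bxor x a) := by
      intro x y hxy
      have h := congrArg (fun z : Fin (6 + 6) → Bool => bxor z a) hxy
      have ex : bxor (bxor x a) a = x := by funext i; show ((x i ^^ a i) ^^ a i) = x i; cases x i <;> cases a i <;> rfl
      have ey : bxor (bxor y a) a = y := by funext i; show ((y i ^^ a i) ^^ a i) = y i; cases y i <;> cases a i <;> rfl
      simp only [ex, ey] at h
      exact h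
    rw [htrans, card_image_of_injective _ hinj] at hflat
    have hc : ∀ i, c (insert i J) =
        (#(univ.filter fun x : Fin (6 + 6) → Bool => (∀ l, x l = true → l ∈ insert i J) ∧ κ x = true) : ℤ) := fun i => rfl
    simp only [hc]
    omega
  -- dual form: `c(T) ≡ N₃(Tᶜ) (mod 2)` for `|T| = 3`
  have hdual : ∀ T : Finset (Fin (6 + 6)), #T = 3 →
      c T % 2 = ((#{S' ∈ p.support.powerset | #S' = 3 ∧ (S'.biUnion fun s => s.support) = Tᶜ} : ℕ) : ℤ) % 2 := by
    intro T hT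
    have h := tdf_cube3_class g p u hp hrep hu hodd T hT
    have hset : (univ.filter fun x : Fin (6 + 6) → Bool => (∀ i, x i = true → i ∈ T) ∧ κ x = true) =
        ({x : Fin (6 + 6) → Bool | ∀ i, x i = true → i ∈ T} : Finset _).filter fun x => u x % 8 = 1 ∨ u x % 8 = 7 := by
      rw [filter_filter]
      refine filter_congr fun x _ => ?_
      rw [hκdef]; simp only [decide_eq_true_eq]
    rw [hcdef]; simp only
    rw [hset]
    exact_mod_cast congrArg (fun n : ℕ => (n : ℤ)) h
  -- the double sum `S = Σ_{w ∈ A} Σ_{s ∋ v, w ∉ supp s ∖ v} N₃((insert w (supp s ∖ v))ᶜ)`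
  set N : Fin (6 + 6) → (Fin (6 + 6) →₀ ℕ) → ℤ := fun w s =>
    ((#{S' ∈ p.support.powerset | #S' = 3 ∧ (S'.biUnion fun s => s.support) = (insert w (s.support.erase v))ᶜ} : ℕ) : ℤ)
    with hNdef
  set S : ℤ := ∑ w ∈ A, ∑ s ∈ p.support.filter (fun s => v ∈ s.support ∧ w ∉ s.support.erase v), N w s with hSdef
  -- (1) `S` is odd: diagonal `N₄`, off-diagonal even
  have hS1 : S % 2 = 1 := by
    have hterm : ∀ w ∈ A, (∑ s ∈ p.support.filter (fun s => v ∈ s.support ∧ w ∉ s.support.erase v), N w s) % 2 =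
        if w = v then 1 else 0 := by
      intro w _
      by_cases hwv : w = v
      · rw [if_pos hwv, hwv]
        have hfil : p.support.filter (fun s => v ∈ s.support ∧ v ∉ s.support.erase v) =
            p.support.filter (fun s => v ∈ s.support) := by
          refine filter_congr fun s _ => ?_
          simp
        rw [hfil]
        have hN : ∀ s ∈ p.support.filter (fun s => v ∈ s.support), N v s =
            ((#{S' ∈ p.support.powerset | #S' = 3 ∧ (S'.biUnion fun s => s.support) = s.supportᶜ} : ℕ) : ℤ) := by
          intro s hs
          rw [hNdef]; simp only
          rw [insert_erase (mem_filter.1 hs).2]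
        rw [sum_congr rfl hN, ← Nat.cast_sum, ← tdp_card_saturated_four_at p hp v]
        have h4 := tdn_N4_odd g p u hp hrep hu hodd
        rcases h4 with ⟨m, hm⟩
        rw [hm]; push_cast; omega
      · rw [if_neg hwv]
        have hfil : p.support.filter (fun s => v ∈ s.support ∧ w ∉ s.support.erase v) =
            p.support.filter (fun s => v ∈ s.support ∧ w ∉ s.support) := by
          refine filter_congr fun s _ => ?_
          simp [mem_erase, hwv]
        rw [hfil]
        have hev := tdp_offdiag_even p hp v w (Ne.symm hwv)
        rcases hev with ⟨m, hm⟩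
        rw [hNdef]; simp only
        rw [← Nat.cast_sum, hm]; push_cast; omega
    rw [hSdef, Finset.sum_int_mod, sum_congr rfl hterm, sum_ite_eq' A v, if_pos hvA]
    decide
  -- (2) `S` is even: exchange the sums and use (*) monomial by monomial
  have hS0 : S % 2 = 0 := by
    have hswap : S = ∑ s ∈ p.support.filter (fun s => v ∈ s.support),
        ∑ w ∈ A.filter (fun w => w ∉ s.support.erase v), N w s := by
      rw [hSdef]
      have h1 : ∀ w ∈ A, ∑ s ∈ p.support.filter (fun s => v ∈ s.support ∧ w ∉ s.support.erase v), N w s =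
          ∑ s ∈ p.support.filter (fun s => v ∈ s.support), if w ∉ s.support.erase v then N w s else 0 := by
        intro w _
        rw [sum_filter, sum_filter]
        refine sum_congr rfl fun s _ => ?_
        by_cases h1 : v ∈ s.support <;> by_cases h2 : w ∉ s.support.erase v <;> simp [h1, h2]
      rw [sum_congr rfl h1, sum_comm]
      refine sum_congr rfl fun s _ => ?_
      conv_rhs => rw [sum_filter]
    rw [hswap, Finset.sum_int_mod]
    have hterm : ∀ s ∈ p.support.filter (fun s => v ∈ s.support),
        (∑ w ∈ A.filter (fun w => w ∉ s.support.erase v), N w s) % 2 = 0 := by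
      intro s hs
      obtain ⟨hsp, hvs⟩ := mem_filter.1 hs
      have h3 : #s.support ≤ 3 := ax_card_support_le hp hsp
      set J := s.support.erase v with hJdef
      have hJcard : #J = #s.support - 1 := by rw [hJdef, card_erase_of_mem hvs]
      by_cases hs3 : #s.support = 3
      · -- `|J| = 2`: the inner sum is `Σ_{w ∈ A ∖ J} N₃((J ∪ {w})ᶜ) ≡ Σ c(J ∪ {w}) ≡ 0`
        have hJ2 : #J = 2 := by rw [hJcard, hs3]
        have hfil : A.filter (fun w => w ∉ J) = A \ J := by
          ext w; simp [mem_sdiff]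
        rw [hfil]
        have hN : ∀ w ∈ A \ J, N w s % 2 = c (insert w J) % 2 := by
          intro w hw
          have hwJ : w ∉ J := (mem_sdiff.1 hw).2
          rw [hdual (insert w J) (by rw [card_insert_of_notMem hwJ, hJ2])]
        rw [Finset.sum_int_mod, sum_congr rfl hN, ← Finset.sum_int_mod]
        exact hstar J hJ2
      · -- `|supp s| ≤ 2`: every `N₃` vanishes
        have hN0 : ∀ w ∈ A.filter (fun w => w ∉ J), N w s = 0 := by
          intro w hw
          have hwJ : w ∉ J := (mem_filter.1 hw).2
          rw [hNdef]; simp only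
          rw [tdn_tilings3_eq_zero p hp]
          · simp
          · rw [card_compl, Fintype.card_fin, ← hJdef, card_insert_of_notMem hwJ, hJcard]
            have hpos := card_pos.2 ⟨v, hvs⟩
            omega
        rw [sum_congr rfl hN0, sum_const_zero]
        rfl
    rw [sum_congr rfl hterm, sum_const_zero]
    rfl
  omega

end NoPeriod

end Summit.QuantumAdvantage.QuantumAdvantage.Theorems.CubicForrelation.NearExactIsExact

end
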